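import Summits.QuantumFields.YangMills.Theses.ComplexCouplingChannel
import Literature.MathematicalPhysics.QuantumFieldTheory.WilsonFinTorusPartitionComplex

/-!
# Line `regime-cut` for crux `FreeEnergyWindowChannel` (stmt-QuantumFields-18842)

Crux-strategist skeleton (planner-cstrat-stmt-QuantumFields-18842-b1-0, 2026-08-17; v3).

The crux (route `ComplexCouplingChannel`, rank 3): for every compact simple `G` and faithful
unitary `r`, beyond some `β₁`, every real coupling `β ≥ β₁` is joined to the strong-coupling
anchor by an open connected complex-coupling CHANNEL `D` on which the symmetric-torus Wilson
partition functions `Z(z; P, P)` (`P ≥ P₀`) are zero-free with a BOUNDED continuation of the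
finite-size free energy, `|log|Z(z;P,P)| + P⁴ Re f(z)| ≤ M` for one analytic `f`.  The crux's
inline `let Zc := …` is, by `rfl`, `fun z a t => wilsonFinTorusPartitionC r.ρ z a a a t`
(`Literature/…/WilsonFinTorusPartitionComplex.lean`, `wilsonFinTorusPartitionC_eq_inline`), over which
the stubs below are stated.

This line cuts the crux BY COUPLING REGIME, not by clause:

* `stub_cumulantControl` (physics, weak coupling, REAL coupling only — stated on the REAL partition
  function `wilsonFinTorusPartition`): at every large real `β₀` the Taylor data at `β₀` of the
  finite-torus free energies `t ↦ log Z(t;P,P,P,P)` are those of ONE real-analytic germ up to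
  `O(1)`-bounded, `n! Cⁿ`-controlled finite-size corrections (volume-uniform cumulant bounds for the
  total Wilson action: the "strong cluster property with finite-size control",
  Duneau–Iagolnitzer–Souillard 1973/74, in real-variable form).
* `stub_windowOfCumulants` (one complex variable, provable): such Taylor control at a real point
  forces a `P`-uniform zero-free complex disc with a bounded analytic continuation (majorant series
  + identity theorem) — the LOCAL WINDOW at `β₀`.
* `stub_anchorReachesWeakCoupling` (physics, global/topological, the non-abelian input): the
  anchor's window continues, through `ℂ` if bulk first-order lines must be skirted, to SOME real
  coupling `βs` beyond any prescribed threshold, arriving there as a clean disc (nothing of the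
  channel lies to the right of `Re z = βs` except that disc).
* `stub_slide` (one complex variable + plane topology, provable): a disciplined channel to `βs`
  plus local windows at every real point of `[βs, β]` give a channel to `β` (Lebesgue number, bead
  chain along the real axis, patching of the analytic `f`'s up to imaginary constants on CONVEX
  overlaps — the discipline is what kills the period obstruction).

Proved here (no stub): `entire_real_pos` — each `z ↦ wilsonFinTorusPartitionC r.ρ z a a a t` is
entire and real-positive on the real axis (Literature: `differentiable_wilsonFinTorusPartitionC`,
`wilsonFinTorusPartitionC_ofReal`, `wilsonFinTorusPartition_pos`; second countability of `G` from
the faithful representation), and `norm_ofReal_eq`.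
`FreeEnergyWindowChannel_of` assembles everything (sorry-free): `β₁(crux) := βs(β₁(cumulants))`.

In-tree analysis the provable stubs can reuse (landed for item stmt-QuantumFields-18844):
`Summit.QuantumFields.YangMills.Theorems.ComplexCouplingChannel.exists_eq_const_of_re_eq_zero`
(zero real part ⇒ imaginary constant), `exists_differentiableOn_exp_eq` (holomorphic logarithm),
`norm_le_of_re_le_of_norm_zero_le` (Borel–Carathéodory), `exists_exponent_norm_le_rpow_mul_rpow`
(disc chains inside an open preconnected set).
-/

open MeasureTheory

namespace Summit.QuantumFields.YangMills.Cruxes.FreeEnergyWindowChannel.RegimeCut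

/-- STUB S1 (physics; weak coupling; REAL coupling only; difficulty: open-problem). Volume-uniform
Taylor/cumulant control of the symmetric-torus free energies at every large real coupling `β₀`: one
germ `(F, k 1, k 2, …)` with `|k n| ≤ A n! Cⁿ`, and finite-size deviations of `log Z(β₀;P,P,P,P)`
and of all its real `t`-derivatives (`(−1)ⁿ ×` the cumulants of the total Wilson action under the
Gibbs probability measure at `β₀`) bounded by `A n! Cⁿ`, uniformly in `P ≥ P₀`. The `O(1)` clause
(n = 0) is massive-phase input (massless free fields on `T⁴` carry a `−log P` term), so this is NOT
a group-blind statement even though it concerns weak coupling; it is a consequence of the crux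
(Cauchy estimates on the local window) and strictly weaker (no anchor connection). -/
theorem stub_cumulantControl :
    ∀ (G : Type) [Group G] [TopologicalSpace G] [IsTopologicalGroup G] [CompactSpace G] [MeasurableSpace G] [BorelSpace G], Literature.MathematicalPhysics.QuantumFieldTheory.IsCompactSimpleLieGroup G → ∀ r : Literature.MathematicalPhysics.QuantumFieldTheory.LatticeRep G,
    ∃ β₁ : ℝ, ∀ β₀ : ℝ, β₁ ≤ β₀ →
      ∃ C A F : ℝ, ∃ k : ℕ → ℝ, ∃ P₀ : ℕ, 0 < C ∧
        (∀ n : ℕ, 1 ≤ n → |k n| ≤ A * n.factorial * C ^ n) ∧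
        ∀ P : ℕ, P₀ ≤ P →
          |Real.log (Literature.MathematicalPhysics.QuantumFieldTheory.wilsonFinTorusPartition r.ρ β₀ P P P P) + (P : ℝ) ^ 4 * F| ≤ A ∧
          ∀ n : ℕ, 1 ≤ n →
            |iteratedDeriv n (fun t : ℝ => Real.log (Literature.MathematicalPhysics.QuantumFieldTheory.wilsonFinTorusPartition r.ρ t P P P P)) β₀ +
                (P : ℝ) ^ 4 * k n| ≤ A * n.factorial * C ^ n := by
  sorry

/-- STUB S2 (one complex variable; provable, size L). Taylor control at a real point `β₀`, uniform in
the family index `P`, forces a `P`-uniform zero-free disc `ball β₀ δ` (`δ = 1/(2C)`) on which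
`log‖Z‖ + P⁴ Re f` is bounded (`M = 2A`) for the analytic `f(β₀+w) = F + Σ_(n≥1) k n wⁿ/n!`
(majorant series; `exp` of the Taylor series of `log Z(·;P)` equals `Z(·;P)` on the disc by the
identity theorem, so `Z ≠ 0` there). No property of the family beyond the hypotheses is used. -/
theorem stub_windowOfCumulants :
    ∀ (Z : ℂ → ℕ → ℂ) (β₀ : ℝ),
    (∀ P : ℕ, Differentiable ℂ fun z : ℂ => Z z P) →
    (∀ (P : ℕ) (t : ℝ), Z (t : ℂ) P = ((Z (t : ℂ) P).re : ℂ) ∧ 0 < (Z (t : ℂ) P).re) →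
    (∃ C A F : ℝ, ∃ k : ℕ → ℝ, ∃ P₀ : ℕ, 0 < C ∧
        (∀ n : ℕ, 1 ≤ n → |k n| ≤ A * n.factorial * C ^ n) ∧
        ∀ P : ℕ, P₀ ≤ P →
          |Real.log ‖Z (β₀ : ℂ) P‖ + (P : ℝ) ^ 4 * F| ≤ A ∧
          ∀ n : ℕ, 1 ≤ n →
            |iteratedDeriv n (fun t : ℝ => Real.log ‖Z (t : ℂ) P‖) β₀ + (P : ℝ) ^ 4 * k n|
              ≤ A * n.factorial * C ^ n) →
    ∃ δ : ℝ, 0 < δ ∧ ∃ f : ℂ → ℂ, DifferentiableOn ℂ f (Metric.ball (β₀ : ℂ) δ) ∧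
      ∃ M : ℝ, ∃ P₀ : ℕ, ∀ P : ℕ, P₀ ≤ P → ∀ z ∈ Metric.ball (β₀ : ℂ) δ,
        Z z P ≠ 0 ∧ |Real.log ‖Z z P‖ + (P : ℝ) ^ 4 * (f z).re| ≤ M := by
  sorry

/-- STUB S3 (physics; global; the non-abelian input; difficulty: open-problem). The strong-coupling
anchor's window reaches real couplings beyond any threshold: for every `b` there are `βs ≥ b`, a
radius `r₀ > 0` and an open connected `D ∋ 0` carrying a window (zero-free symmetric tori with a
bounded analytic continuation of the finite-size free energy) such that `ball βs r₀ ⊆ D` and `D`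
has nothing to the right of `Re z = βs` except that disc (the channel may skirt bulk first-order
lines through `ℂ`, but arrives at `βs` along the axis — this discipline is what makes the slide S4
period-free). Instances with `b` inside the strong-coupling disc are the route's anchor support
item (stmt-QuantumFields-18843). `U(1)₄`-false in intent (pinch at `β_c`). -/
theorem stub_anchorReachesWeakCoupling :
    ∀ (G : Type) [Group G] [TopologicalSpace G] [IsTopologicalGroup G] [CompactSpace G] [MeasurableSpace G] [BorelSpace G], Literature.MathematicalPhysics.QuantumFieldTheory.IsCompactSimpleLieGroup G → ∀ r : Literature.MathematicalPhysics.QuantumFieldTheory.LatticeRep G,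
    ∀ b : ℝ, ∃ βs : ℝ, b ≤ βs ∧ ∃ r₀ : ℝ, 0 < r₀ ∧ ∃ D : Set ℂ, IsOpen D ∧ IsConnected D ∧ (0 : ℂ) ∈ D ∧
      Metric.ball (βs : ℂ) r₀ ⊆ D ∧ D ⊆ {z : ℂ | z.re < βs} ∪ Metric.ball (βs : ℂ) r₀ ∧
      ∃ f : ℂ → ℂ, DifferentiableOn ℂ f D ∧ ∃ M : ℝ, ∃ P₀ : ℕ, ∀ P : ℕ, P₀ ≤ P → ∀ z ∈ D,
        Literature.MathematicalPhysics.QuantumFieldTheory.wilsonFinTorusPartitionC r.ρ z P P P P ≠ 0 ∧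
          |Real.log ‖Literature.MathematicalPhysics.QuantumFieldTheory.wilsonFinTorusPartitionC r.ρ z P P P P‖ + (P : ℝ) ^ 4 * (f z).re| ≤ M := by
  sorry

/-- STUB S4 (one complex variable + plane topology; provable, size M/L). SLIDE: a disciplined window
reaching `βs` from `0`, plus local windows at every real point of `[βs, β]`, give a window on an
open connected set containing `0` and `β`. Proof sketch: Lebesgue number `ℓ` of the cover of
`[βs, β]`; beads `ball (βs + k s) ρ` with `ρ ≤ min (ℓ/3) (r₀/2)`, `ρ < s < 2ρ`; each new bead meets
the previous union in `(ball βs r₀ ∩ bead) ∪ (previous bead ∩ bead)`, two convex lenses sharing a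
real point, hence a connected open set, on which the two analytic `f`'s have equal real parts
(let `P → ∞` in the two bounds) and so differ by an imaginary constant (open mapping); patch.
No property of `Z` is used. -/
theorem stub_slide :
    ∀ (Z : ℂ → ℕ → ℂ) (βs β : ℝ), βs ≤ β →
    (∃ r₀ : ℝ, 0 < r₀ ∧ ∃ D : Set ℂ, IsOpen D ∧ IsConnected D ∧ (0 : ℂ) ∈ D ∧
        Metric.ball (βs : ℂ) r₀ ⊆ D ∧ D ⊆ {z : ℂ | z.re < βs} ∪ Metric.ball (βs : ℂ) r₀ ∧
        ∃ f : ℂ → ℂ, DifferentiableOn ℂ f D ∧ ∃ M : ℝ, ∃ P₀ : ℕ, ∀ P : ℕ, P₀ ≤ P → ∀ z ∈ D,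
          Z z P ≠ 0 ∧ |Real.log ‖Z z P‖ + (P : ℝ) ^ 4 * (f z).re| ≤ M) →
    (∀ x : ℝ, x ∈ Set.Icc βs β → ∃ δ : ℝ, 0 < δ ∧ ∃ f : ℂ → ℂ,
        DifferentiableOn ℂ f (Metric.ball (x : ℂ) δ) ∧
        ∃ M : ℝ, ∃ P₀ : ℕ, ∀ P : ℕ, P₀ ≤ P → ∀ z ∈ Metric.ball (x : ℂ) δ,
          Z z P ≠ 0 ∧ |Real.log ‖Z z P‖ + (P : ℝ) ^ 4 * (f z).re| ≤ M) →
    ∃ D : Set ℂ, IsOpen D ∧ IsConnected D ∧ (0 : ℂ) ∈ D ∧ (β : ℂ) ∈ D ∧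
      ∃ f : ℂ → ℂ, DifferentiableOn ℂ f D ∧ ∃ M : ℝ, ∃ P₀ : ℕ, ∀ P : ℕ, P₀ ≤ P → ∀ z ∈ D,
        Z z P ≠ 0 ∧ |Real.log ‖Z z P‖ + (P : ℝ) ^ 4 * (f z).re| ≤ M := by
  sorry

/-- (Proved helper, not a stub.) Every complex-coupling box partition function
`z ↦ wilsonFinTorusPartitionC r.ρ z a a a t` is entire, and real and strictly positive at real
coupling. [folklore] -/
theorem entire_real_pos (G : Type) [Group G] [TopologicalSpace G] [IsTopologicalGroup G]
    [CompactSpace G] [MeasurableSpace G] [BorelSpace G]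
    (r : Literature.MathematicalPhysics.QuantumFieldTheory.LatticeRep G) :
    (∀ a t : ℕ, Differentiable ℂ fun z : ℂ => Literature.MathematicalPhysics.QuantumFieldTheory.wilsonFinTorusPartitionC r.ρ z a a a t) ∧
    ∀ (a t : ℕ) (x : ℝ), Literature.MathematicalPhysics.QuantumFieldTheory.wilsonFinTorusPartitionC r.ρ (x : ℂ) a a a t = ((Literature.MathematicalPhysics.QuantumFieldTheory.wilsonFinTorusPartitionC r.ρ (x : ℂ) a a a t).re : ℂ) ∧
      0 < (Literature.MathematicalPhysics.QuantumFieldTheory.wilsonFinTorusPartitionC r.ρ (x : ℂ) a a a t).re := by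
  haveI : SecondCountableTopology G :=
    (r.continuous.isClosedEmbedding r.injective).isEmbedding.secondCountableTopology
  refine ⟨fun a t =>
    Literature.MathematicalPhysics.QuantumFieldTheory.differentiable_wilsonFinTorusPartitionC
      r.ρ r.continuous a a a t, fun a t x => ?_⟩
  rw [Literature.MathematicalPhysics.QuantumFieldTheory.wilsonFinTorusPartitionC_ofReal]
  refine ⟨by simp, ?_⟩
  simpa using
    Literature.MathematicalPhysics.QuantumFieldTheory.wilsonFinTorusPartition_pos r.continuous x a a a t

/-- (Proved helper.) At real coupling `‖Z_ℂ(t)‖ = Z_ℝ(t)`. [folklore] -/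
theorem norm_ofReal_eq (G : Type) [Group G] [TopologicalSpace G] [IsTopologicalGroup G]
    [CompactSpace G] [MeasurableSpace G] [BorelSpace G]
    (r : Literature.MathematicalPhysics.QuantumFieldTheory.LatticeRep G) (t : ℝ) (a b c d : ℕ) :
    ‖Literature.MathematicalPhysics.QuantumFieldTheory.wilsonFinTorusPartitionC r.ρ (t : ℂ) a b c d‖ =
      Literature.MathematicalPhysics.QuantumFieldTheory.wilsonFinTorusPartition r.ρ t a b c d := by
  haveI : SecondCountableTopology G :=
    (r.continuous.isClosedEmbedding r.injective).isEmbedding.secondCountableTopology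
  simp only [Literature.MathematicalPhysics.QuantumFieldTheory.wilsonFinTorusPartitionC_ofReal,
    Complex.norm_real, Real.norm_eq_abs,
    abs_of_pos (Literature.MathematicalPhysics.QuantumFieldTheory.wilsonFinTorusPartition_pos
      r.continuous t a b c d)]

/-- COMPOSITION (sorry-free): the four stub statements imply the crux BY NAME.
`β₁(crux) := βs`, where `βs ≥ β₁(S1)` is the coupling reached by the anchor channel (S3); for
`β ≥ βs` slide along `[βs, β]` (S4) using the local windows manufactured from S1 by S2 (with the
proved `entire_real_pos`, `norm_ofReal_eq`); the anchor point `x := 0` serves every `ρ > 0`; the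
crux's `let Zc` is `wilsonFinTorusPartitionC r.ρ` definitionally. -/
theorem FreeEnergyWindowChannel_of
    (h1 : ∀ (G : Type) [Group G] [TopologicalSpace G] [IsTopologicalGroup G] [CompactSpace G] [MeasurableSpace G] [BorelSpace G], Literature.MathematicalPhysics.QuantumFieldTheory.IsCompactSimpleLieGroup G → ∀ r : Literature.MathematicalPhysics.QuantumFieldTheory.LatticeRep G,
          ∃ β₁ : ℝ, ∀ β₀ : ℝ, β₁ ≤ β₀ →
            ∃ C A F : ℝ, ∃ k : ℕ → ℝ, ∃ P₀ : ℕ, 0 < C ∧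
              (∀ n : ℕ, 1 ≤ n → |k n| ≤ A * n.factorial * C ^ n) ∧
              ∀ P : ℕ, P₀ ≤ P →
                |Real.log (Literature.MathematicalPhysics.QuantumFieldTheory.wilsonFinTorusPartition r.ρ β₀ P P P P) + (P : ℝ) ^ 4 * F| ≤ A ∧
                ∀ n : ℕ, 1 ≤ n →
                  |iteratedDeriv n (fun t : ℝ => Real.log (Literature.MathematicalPhysics.QuantumFieldTheory.wilsonFinTorusPartition r.ρ t P P P P)) β₀ +
                      (P : ℝ) ^ 4 * k n| ≤ A * n.factorial * C ^ n)
    (h2 : ∀ (Z : ℂ → ℕ → ℂ) (β₀ : ℝ),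
          (∀ P : ℕ, Differentiable ℂ fun z : ℂ => Z z P) →
          (∀ (P : ℕ) (t : ℝ), Z (t : ℂ) P = ((Z (t : ℂ) P).re : ℂ) ∧ 0 < (Z (t : ℂ) P).re) →
          (∃ C A F : ℝ, ∃ k : ℕ → ℝ, ∃ P₀ : ℕ, 0 < C ∧
              (∀ n : ℕ, 1 ≤ n → |k n| ≤ A * n.factorial * C ^ n) ∧
              ∀ P : ℕ, P₀ ≤ P →
                |Real.log ‖Z (β₀ : ℂ) P‖ + (P : ℝ) ^ 4 * F| ≤ A ∧
                ∀ n : ℕ, 1 ≤ n →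
                  |iteratedDeriv n (fun t : ℝ => Real.log ‖Z (t : ℂ) P‖) β₀ + (P : ℝ) ^ 4 * k n|
                    ≤ A * n.factorial * C ^ n) →
          ∃ δ : ℝ, 0 < δ ∧ ∃ f : ℂ → ℂ, DifferentiableOn ℂ f (Metric.ball (β₀ : ℂ) δ) ∧
            ∃ M : ℝ, ∃ P₀ : ℕ, ∀ P : ℕ, P₀ ≤ P → ∀ z ∈ Metric.ball (β₀ : ℂ) δ,
              Z z P ≠ 0 ∧ |Real.log ‖Z z P‖ + (P : ℝ) ^ 4 * (f z).re| ≤ M)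
    (h3 : ∀ (G : Type) [Group G] [TopologicalSpace G] [IsTopologicalGroup G] [CompactSpace G] [MeasurableSpace G] [BorelSpace G], Literature.MathematicalPhysics.QuantumFieldTheory.IsCompactSimpleLieGroup G → ∀ r : Literature.MathematicalPhysics.QuantumFieldTheory.LatticeRep G,
          ∀ b : ℝ, ∃ βs : ℝ, b ≤ βs ∧ ∃ r₀ : ℝ, 0 < r₀ ∧ ∃ D : Set ℂ, IsOpen D ∧ IsConnected D ∧ (0 : ℂ) ∈ D ∧
            Metric.ball (βs : ℂ) r₀ ⊆ D ∧ D ⊆ {z : ℂ | z.re < βs} ∪ Metric.ball (βs : ℂ) r₀ ∧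
            ∃ f : ℂ → ℂ, DifferentiableOn ℂ f D ∧ ∃ M : ℝ, ∃ P₀ : ℕ, ∀ P : ℕ, P₀ ≤ P → ∀ z ∈ D,
              Literature.MathematicalPhysics.QuantumFieldTheory.wilsonFinTorusPartitionC r.ρ z P P P P ≠ 0 ∧
                |Real.log ‖Literature.MathematicalPhysics.QuantumFieldTheory.wilsonFinTorusPartitionC r.ρ z P P P P‖ + (P : ℝ) ^ 4 * (f z).re| ≤ M)
    (h4 : ∀ (Z : ℂ → ℕ → ℂ) (βs β : ℝ), βs ≤ β →
          (∃ r₀ : ℝ, 0 < r₀ ∧ ∃ D : Set ℂ, IsOpen D ∧ IsConnected D ∧ (0 : ℂ) ∈ D ∧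
              Metric.ball (βs : ℂ) r₀ ⊆ D ∧ D ⊆ {z : ℂ | z.re < βs} ∪ Metric.ball (βs : ℂ) r₀ ∧
              ∃ f : ℂ → ℂ, DifferentiableOn ℂ f D ∧ ∃ M : ℝ, ∃ P₀ : ℕ, ∀ P : ℕ, P₀ ≤ P → ∀ z ∈ D,
                Z z P ≠ 0 ∧ |Real.log ‖Z z P‖ + (P : ℝ) ^ 4 * (f z).re| ≤ M) →
          (∀ x : ℝ, x ∈ Set.Icc βs β → ∃ δ : ℝ, 0 < δ ∧ ∃ f : ℂ → ℂ,
              DifferentiableOn ℂ f (Metric.ball (x : ℂ) δ) ∧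
              ∃ M : ℝ, ∃ P₀ : ℕ, ∀ P : ℕ, P₀ ≤ P → ∀ z ∈ Metric.ball (x : ℂ) δ,
                Z z P ≠ 0 ∧ |Real.log ‖Z z P‖ + (P : ℝ) ^ 4 * (f z).re| ≤ M) →
          ∃ D : Set ℂ, IsOpen D ∧ IsConnected D ∧ (0 : ℂ) ∈ D ∧ (β : ℂ) ∈ D ∧
            ∃ f : ℂ → ℂ, DifferentiableOn ℂ f D ∧ ∃ M : ℝ, ∃ P₀ : ℕ, ∀ P : ℕ, P₀ ≤ P → ∀ z ∈ D,
              Z z P ≠ 0 ∧ |Real.log ‖Z z P‖ + (P : ℝ) ^ 4 * (f z).re| ≤ M) :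
    Summit.QuantumFields.YangMills.Theses.ComplexCouplingChannel.FreeEnergyWindowChannel := by
  intro G _ _ _ _ _ _ hG r Zc
  obtain ⟨hdiff, hreal⟩ := entire_real_pos G r
  have hnorm := norm_ofReal_eq G r
  obtain ⟨β₁, hcum⟩ := h1 G hG r
  obtain ⟨βs, hβs, r₀, hr₀, D, hDo, hDc, h0D, hball, hDsub, f, hf, M, P₀, hwin⟩ := h3 G hG r β₁
  refine ⟨βs, fun β hβ ρ hρ => ?_⟩
  have hloc : ∀ x : ℝ, x ∈ Set.Icc βs β → ∃ δ : ℝ, 0 < δ ∧ ∃ f : ℂ → ℂ,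
      DifferentiableOn ℂ f (Metric.ball (x : ℂ) δ) ∧
      ∃ M : ℝ, ∃ P₀ : ℕ, ∀ P : ℕ, P₀ ≤ P → ∀ z ∈ Metric.ball (x : ℂ) δ,
        Literature.MathematicalPhysics.QuantumFieldTheory.wilsonFinTorusPartitionC r.ρ z P P P P ≠ 0 ∧
          |Real.log ‖Literature.MathematicalPhysics.QuantumFieldTheory.wilsonFinTorusPartitionC r.ρ z P P P P‖ + (P : ℝ) ^ 4 * (f z).re| ≤ M := by
    intro x hx
    obtain ⟨C, A, F, k, P₁, hC, hk, hP⟩ := hcum x (le_trans hβs hx.1)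
    refine h2 (fun z P => Literature.MathematicalPhysics.QuantumFieldTheory.wilsonFinTorusPartitionC r.ρ z P P P P) x (fun P => hdiff P P) (fun P t => hreal P P t)
      ⟨C, A, F, k, P₁, hC, hk, fun P hP₁ => ?_⟩
    obtain ⟨h0, hn⟩ := hP P hP₁
    have hfun : (fun t : ℝ => Real.log ‖Literature.MathematicalPhysics.QuantumFieldTheory.wilsonFinTorusPartitionC r.ρ (t : ℂ) P P P P‖) =
        fun t : ℝ => Real.log (Literature.MathematicalPhysics.QuantumFieldTheory.wilsonFinTorusPartition r.ρ t P P P P) := funext fun t => by rw [hnorm]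
    refine ⟨?_, fun n hn1 => ?_⟩
    · show |Real.log ‖Literature.MathematicalPhysics.QuantumFieldTheory.wilsonFinTorusPartitionC r.ρ (x : ℂ) P P P P‖ + (P : ℝ) ^ 4 * F| ≤ A
      rw [hnorm]; exact h0
    · show |iteratedDeriv n (fun t : ℝ => Real.log ‖Literature.MathematicalPhysics.QuantumFieldTheory.wilsonFinTorusPartitionC r.ρ (t : ℂ) P P P P‖) x +
          (P : ℝ) ^ 4 * k n| ≤ A * n.factorial * C ^ n
      rw [hfun]; exact hn n hn1
  obtain ⟨D', hD'o, hD'c, h0D', hβD', f', hf', M', P₀', hwin'⟩ :=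
    h4 (fun z P => Literature.MathematicalPhysics.QuantumFieldTheory.wilsonFinTorusPartitionC r.ρ z P P P P) βs β hβ
      ⟨r₀, hr₀, D, hDo, hDc, h0D, hball, hDsub, f, hf, M, P₀, hwin⟩ hloc
  refine ⟨D', hD'o, hD'c, hβD', ⟨0, by simpa using hρ, by simpa using h0D'⟩, f', hf', M', P₀', ?_⟩
  intro P hP z hz
  exact hwin' P hP z hz

/-- The registered stubs compose to the crux (documents the exact match between the stub
signatures and the hypotheses of `FreeEnergyWindowChannel_of`; depends on the stubs' `sorry`s). -/
theorem FreeEnergyWindowChannel_of_stubs :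
    Summit.QuantumFields.YangMills.Theses.ComplexCouplingChannel.FreeEnergyWindowChannel :=
  FreeEnergyWindowChannel_of stub_cumulantControl stub_windowOfCumulants
    stub_anchorReachesWeakCoupling stub_slide

end Summit.QuantumFields.YangMills.Cruxes.FreeEnergyWindowChannel.RegimeCut
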